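import Summits.BirchSwinnertonDyer.BirchSwinnertonDyer.Theses.CumulativeHeegnerLeopoldt
import Summits.BirchSwinnertonDyer.BirchSwinnertonDyer.Theses.UniversalToricDescent
import Summits.BirchSwinnertonDyer.BirchSwinnertonDyer.Theorems.AdditivePotSupersingularControlOfFacts
import Summits.BirchSwinnertonDyer.BirchSwinnertonDyer.Theorems.CumulativeHeegnerLeopoldtRedSplitControlAtThreeTorsionFree
import Summits.BirchSwinnertonDyer.Rank1Residual.GaloisImage.PropagatedConditionCardEP
import Literature.NumberTheory.EllipticCurves.Serre1967.PotentiallySupersingularNoStableLineProofs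
import Literature.NumberTheory.EllipticCurves.AnticyclotomicPrimeDecompositionSplitProofs
import Literature.NumberTheory.EllipticCurves.AnticyclotomicPrimeDecompositionAboveProofs
import Literature.NumberTheory.GaloisRepresentations.NumberFieldCdTwoProofs
import HarnessLib

/-!
# Crux K4 `RedSplitControlAtThree` (stmt-BirchSwinnertonDyer-24200, route `CumulativeHeegnerLeopoldt`)
# from the two Poitou–Tate LEAF ITEMS of route `UniversalToricDescent` BY NAME

Seat `bsd-line-chl-p2` g0 (cell `bsd-wall`). The same twelve-line argument as
`RedSplitControlAtThreeOfFacts.redSplitControlAtThree_of_poitouTate` (module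
`CumulativeHeegnerLeopoldtRedSplitControlAtThree`, not imported here so that this two-route glue sits directly
on the two route files and on route-independent modules only): the two remaining named-fact hypotheses of K4
are, by name, the OPEN support leaves `PoitouTateSelmerStructureDualityFact`
(stmt-BirchSwinnertonDyer-20461) and `PoitouTateShaTateDualFact` (stmt-BirchSwinnertonDyer-20462) of route
`UniversalToricDescent` (the gen-1 split of its crux #5 `WildSplitControlAtThree`). So K4 closes by a one-line
glue the moment those two items close — the same residue as UTD's control crux; a planner may restate 24200
as «20461 → 20462 → K4» with this theorem as the closer. HONEST FRAMING: CONDITIONAL (the two leaves are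
cite-level named facts, Milne ADT I 4.10); closes nothing by itself; BSD is not proved by any of this.

References: [MilneADT2006] I Thm. 4.10; [JetchevSkinnerWan2017] Thm. 3.3.1.
-/

set_option linter.dupNamespace false
set_option autoImplicit false

noncomputable section

open scoped Classical

open WeierstrassCurve NumberField IsDedekindDomain Field Literature.NumberTheory.EllipticCurves
  Literature.NumberTheory.GaloisRepresentations
  Literature.NumberTheory.GaloisCohomology
  Literature.NumberTheory.EllipticCurves.Rank1Residual
  Summit.BirchSwinnertonDyer.Rank1Residual.X11b
  Summit.BirchSwinnertonDyer.BirchSwinnertonDyer.Theorems.SchneiderFreeAdditiveX3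
  Summit.BirchSwinnertonDyer.BirchSwinnertonDyer.Theses

namespace Summit.BirchSwinnertonDyer.BirchSwinnertonDyer.Theorems.RedSplitControlAtThreeOfPublishedFacts

/-- **K4 `RedSplitControlAtThree` from UTD's two Poitou–Tate leaves BY NAME**:
`PoitouTateSelmerStructureDualityFact → PoitouTateShaTateDualFact → RedSplitControlAtThree`
(items 20461 → 20462 → 24200): the K1 door `AdditivePotSupersingularControl.additiveControlOnTreeAt_of_classO6_of_facts`
with `E(K)[3] = 0` from the non-anomalous line
(`RedSplitControlAtThreeTorsionFree.forall_nsmul_eq_zero_of_nonAnomalousCell_of_isImaginaryQuadratic`), `SplitsIn K 3`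
from the Heegner hypothesis, rank/Ш from `kolyvagin`, and the five landed fact theorems (local Euler–Poincaré,
`cd ≤ 2`, Brink Thm 2 / Cor 1, Serre 1967 §5 Prop. 8). CONDITIONAL on the two leaves.
[cite: MilneADT2006, Ch. I, Thm. 4.10] [cite: JetchevSkinnerWan2017, Thm. 3.3.1, Prop. 3.3.4 (arXiv:1512.06894 pp. 11–13)]
[cite: Brink2007, Thm. 2 and Cor. 1] [cite: Serre1967GroupesPDivisibles, §5 Prop. 8] -/
theorem redSplitControlAtThree_of_publishedFacts :
    UniversalToricDescent.PoitouTateSelmerStructureDualityFact →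
      UniversalToricDescent.PoitouTateShaTateDualFact →
        CumulativeHeegnerLeopoldt.RedSplitControlAtThree := by
  intro hPT hPT2 W _ _ N _ K _ _ Dt H ι P hO6 _hRed hcell _hr hN hK hHg _hLd hP hPinf hKoly κ hκ γ _ 𝔭 h𝔭 he hf
  have hpN : 3 ∣ W.conductorNorm ℤ :=
    (W.dvd_conductorNorm_iff_not_hasGoodReductionAtPrime 3).mpr hO6.2.1.1
  have hsplit : SplitsIn K 3 := splitsIn_of_satisfiesHeegnerHypothesis hN hHg hpN
  obtain ⟨hrank, hSha⟩ := hKoly hK hHg ⟨Dt, H, ι, hP⟩ hPinf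
  have hivK : ∀ x : (W.baseChange K).toAffine.Point, 3 • x = 0 → x = 0 :=
    RedSplitControlAtThreeTorsionFree.forall_nsmul_eq_zero_of_nonAnomalousCell_of_isImaginaryQuadratic
      K hK 𝔭 h𝔭 he hf hcell
  exact AdditivePotSupersingularControl.additiveControlOnTreeAt_of_classO6_of_facts hPT hPT2
    (fun K _ _ v ↦
      Summit.BirchSwinnertonDyer.Rank1Residual.GaloisImage.EP.localEulerPoincareCharacteristic_adicCompletion K v)
    fieldCdLE_two_of_numberField_holds
    (fun K _ _ p _ ↦ ZpExtension.decomp_not_le_kerSubgroup_of_isAnticyclotomic_holds K p)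
    (fun K _ _ p _ ↦ ZpExtension.decomp_not_le_kerSubgroup_above_of_isAnticyclotomic_holds K p)
    Serre1967.noStableDivisibleLine_of_potentiallySupersingular_holds
    W hO6 K hK hsplit hivK κ hκ γ 𝔭 h𝔭 he hf hrank hSha P hPinf

end Summit.BirchSwinnertonDyer.BirchSwinnertonDyer.Theorems.RedSplitControlAtThreeOfPublishedFacts

end
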